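import Literature.Probability.LatticeModels.MessagerMiracleSole
import Literature.Probability.LatticeModels.CriticalTwoPointBounds
import Literature.Probability.LatticeModels.CriticalCorrWellDefined
import Literature.Probability.LatticeModels.FreeBoundaryReflectionPositivity
import Literature.Probability.LatticeModels.GKSInequalities
import Summits.CriticalPhenomena.Ising3DConformalLimit.Theorems.HyperoctahedralRPCriticalCorrNineMirrorRP
import HarnessLib

/-!
# Four-mirror reflection positivity of the critical plus correlations of `ℤ³`
(route `LatticeSDPCertificates`, helper for item stmt-CriticalPhenomena-5506 `CriticalStateFeasible`)

Row 3 of the lattice-bootstrap feasibility rows (`LatticeBootstrapFeasible`, matrix form of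
Cho–Sun 2023, Def. 12) for the true critical state: for each of the four lattice mirror types of
Fröhlich–Israel–Lieb–Simon 1978 — site plane `x_i = 0`, bond plane `x_i = 1/2`, diagonal plane
`x_i = x_j`, anti-diagonal plane `x_i = -x_j` — finite families `A_a ⊆ {ℓ ≥ 0}` and real `c_a`,
`0 ≤ Σ_{a,b} c_a c_b ⟨σ_{A_a ∆ θ(A_b)}⟩⁺_{β_c(3),0}` (`plusCorr_criticalBeta_fourMirror_rp`).

Proof. For an involution `θ` of `ℤ^d` moving boxes boundedly, the symmetrised boxes
`Λ(L) ∪ θΛ(L)` (`symBox`) are `θ`-stable finite volumes; the free finite-volume Gibbs measures on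
them are reflection positive on the observable `F = Σ_a c_a σ_{A_a}` — through SITES for the three
site-type mirrors (involutive graph automorphisms with an integer level `ℓ`, `ℓ ∘ θ = -ℓ`,
`θ = id` on `{ℓ = 0}`, `|ℓ x - ℓ y| ≤ 1` along edges: the tree theorem
`isingExpect_free_reflect_mul_self_nonneg`, FILS 1978 §2 / Thm. 3.1, Friedli–Velenik 2017
Lemma 10.8), through BONDS for the mirror `x_i ↦ 1 - x_i` of the nearest-neighbour ferromagnet
(`isingExpect_free_reflect_mul_self_nonneg_of_cross`). Expanding
`(F ∘ θ^*) F = Σ_{a,b} c_a c_b σ_{θA_a ∆ A_b}` and letting `L → ∞`: by GKS volume monotonicity the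
free correlations along `Λ(L) ∪ θΛ(L)` are sandwiched between those along `Λ(L)` and `Λ(L+R)`,
which converge to `⟨σ_A⟩⁺_{β,0}` whenever `m*(β) = 0`
(`hasBoxLimit_isingCorr_of_spontaneousMagnetization_eq_zero`, Lebowitz–Martin-Löf /
Friedli–Velenik Thm. 3.28); at `d = 3`, `β = β_c` this is Aizenman–Duminil-Copin–Sidoravicius 2015
(`spontaneousMagnetization_criticalBeta_eq_zero_holds`). The geometric facts about the three site
mirrors are those of `HyperoctahedralRPCriticalCorrNineMirrorRP` (item stmt-CriticalPhenomena-1985),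
the bond mirror is the tree's `axisRefl i 1`.

References: J. Fröhlich, R. Israel, E. H. Lieb, B. Simon, Comm. Math. Phys. 62 (1978) 1–34, §2–3;
S. Friedli, Y. Velenik, *Statistical Mechanics of Lattice Systems* (CUP 2017), Lemma 10.8,
Thm. 3.28; M. Aizenman, H. Duminil-Copin, V. Sidoravicius, Comm. Math. Phys. 334 (2015), Thm. 1.2;
M. Cho, X. Sun, JHEP 11 (2023) 047, Def. 12. No definitions are introduced.
-/

noncomputable section

open Filter MeasureTheory Finset
open scoped Topology BigOperators symmDiff
open Literature.Probability.LatticeModels Literature.Probability.Percolation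

namespace Summit.CriticalPhenomena.Ising3DConformalLimit.LatticeSDPCertificatesFeasible

/-! ### Reflection positivity of the plus correlations: from free finite volumes to `μ_{β}` -/

section RP

variable {d : ℕ}

/-- Free correlations along the `θ`-symmetrised boxes `Λ(L) ∪ θΛ(L)` converge to the plus
correlations when `m*(β) = 0` (sandwich `Λ(L) ⊆ Λ(L) ∪ θΛ(L) ⊆ Λ(L+R)`, GKS volume monotonicity
of the free correlations, and `⟨σ_A⟩^∅_{Λ(L)} → ⟨σ_A⟩⁺` when `m* = 0`). -/
theorem tendsto_isingCorr_free_symBox {θ : Site d ≃ Site d} {R : ℕ}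
    (hR : ∀ L, ∀ y ∈ box d L, θ y ∈ box d (L + R)) {β : ℝ} (hβ : 0 ≤ β)
    (hm : spontaneousMagnetization d β = 0) (A : Finset (Site d)) :
    Tendsto (fun L => isingCorr (zdGraph d) (symBox θ L) β 0 .free A) atTop
      (𝓝 (plusCorr d β 0 A)) := by
  obtain ⟨L₀, hL₀⟩ := exists_forall_subset_box d A
  have hmem : (BoundaryCondition.free : BoundaryCondition (Site d)) ∈
      ({.free, .plus, .minus} : Set (BoundaryCondition (Site d))) := by simp
  have hg : Tendsto (fun L => isingCorr (zdGraph d) (box d L) β 0 .free A) atTop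
      (𝓝 (plusCorr d β 0 A)) :=
    hasBoxLimit_isingCorr_of_spontaneousMagnetization_eq_zero hβ hm A .free hmem
  have hf : Tendsto (fun L => isingCorr (zdGraph d) (box d (L + R)) β 0 .free A) atTop
      (𝓝 (plusCorr d β 0 A)) := (Filter.tendsto_add_atTop_iff_nat R).2 hg
  refine tendsto_of_tendsto_of_tendsto_of_le_of_le' hg hf ?_ ?_
  · filter_upwards [eventually_ge_atTop L₀] with L hL
    exact isingCorr_free_le_of_subset (zdGraph d) hβ le_rfl (hL₀ L hL) (box_subset_symBox θ L)
  · filter_upwards [eventually_ge_atTop L₀] with L hL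
    exact isingCorr_free_le_of_subset (zdGraph d) hβ le_rfl
      ((hL₀ L hL).trans (box_subset_symBox θ L)) (symBox_subset_box hR L)

/-- A spin product seen through a reflected configuration is the spin product of the reflected
set: `σ_A(θ^*τ) = σ_{θA}(τ)`. -/
theorem spinProduct_configReflect_eq_map {V : Type*} (θ : V ≃ V) (A : Finset V)
    (τ : SpinConfig V) :
    spinProduct A (configReflect θ τ) = spinProduct (A.map θ.toEmbedding) τ := by
  unfold spinProduct
  rw [Finset.prod_map]
  rfl

/-- The observable `F = Σ_a c_a σ_{A_a}` is measurable. -/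
theorem measurable_sum_mul_spinProduct {V : Type*} {m : ℕ} (A : Fin m → Finset V)
    (c : Fin m → ℝ) : Measurable fun σ : SpinConfig V => ∑ a, c a * spinProduct (A a) σ :=
  Finset.measurable_sum _ fun a _ => (measurable_spinProduct (A a)).const_mul (c a)

/-- The observable `F = Σ_a c_a σ_{A_a}` depends only on the spins in any set containing the
`A_a`. -/
theorem dependsOn_sum_mul_spinProduct {V : Type*} {m : ℕ} (A : Fin m → Finset V)
    (c : Fin m → ℝ) {P : Set V} (hA : ∀ a, ∀ p ∈ A a, p ∈ P) :
    DependsOn (fun σ : SpinConfig V => ∑ a, c a * spinProduct (A a) σ) P := by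
  intro σ σ' hσ
  refine Finset.sum_congr rfl fun a _ => ?_
  unfold spinProduct spinAt
  congr 1
  exact Finset.prod_congr rfl fun x hx => by rw [hσ x (hA a x hx)]

/-- The observable `F = Σ_a c_a σ_{A_a}` is bounded by `Σ_a |c_a|`. -/
theorem abs_sum_mul_spinProduct_le {V : Type*} {m : ℕ} (A : Fin m → Finset V) (c : Fin m → ℝ)
    (σ : SpinConfig V) : |∑ a, c a * spinProduct (A a) σ| ≤ ∑ a, |c a| := by
  refine (Finset.abs_sum_le_sum_abs _ _).trans (Finset.sum_le_sum fun a _ => ?_)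
  rw [abs_mul]
  exact mul_le_of_le_one_right (abs_nonneg _) (abs_spinProduct_le_one (A a) σ)

/-- **From finite-volume free reflection positivity to the plus state.** If the free Gibbs
measures of the `θ`-symmetrised boxes are reflection positive on the observable
`F = Σ_a c_a σ_{A_a}` (`0 ≤ ⟨(F ∘ θ^*) F⟩^∅_{Λ(L) ∪ θΛ(L);β,0}` for all `L`) and `m*(β) = 0`, then
`0 ≤ Σ_{a,b} c_a c_b ⟨σ_{A_a ∆ θA_b}⟩⁺_{β,0}` (expand `(F ∘ θ^*) F = Σ_{a,b} c_a c_b σ_{θA_a ∆ A_b}`,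
pass to the limit `L → ∞`, and reindex). -/
theorem sum_sum_mul_plusCorr_symmDiff_nonneg_of_free (θ : Site d ≃ Site d) {R : ℕ}
    (hR : ∀ L, ∀ y ∈ box d L, θ y ∈ box d (L + R)) {β : ℝ} (hβ : 0 ≤ β)
    (hm : spontaneousMagnetization d β = 0) {m : ℕ} (A : Fin m → Finset (Site d))
    (c : Fin m → ℝ)
    (hpos : ∀ L, 0 ≤ isingExpect (zdGraph d) (symBox θ L) β 0 .free
      (fun τ => (∑ a, c a * spinProduct (A a) (configReflect θ τ)) *
        ∑ a, c a * spinProduct (A a) τ)) :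
    0 ≤ ∑ a, ∑ b, c a * c b * plusCorr d β 0 (symmDiff (A a) ((A b).image θ)) := by
  classical
  set B : Fin m × Fin m → Finset (Site d) := fun p => ((A p.1).map θ.toEmbedding) ∆ (A p.2)
    with hB
  have hexp : (fun τ : SpinConfig (Site d) =>
      (∑ a, c a * spinProduct (A a) (configReflect θ τ)) * ∑ a, c a * spinProduct (A a) τ) =
      fun τ => ∑ p : Fin m × Fin m, (c p.1 * c p.2) * spinProduct (B p) τ := by
    funext τ
    rw [Fintype.sum_prod_type, Finset.sum_mul_sum]
    refine Finset.sum_congr rfl fun a _ => Finset.sum_congr rfl fun b _ => ?_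
    rw [spinProduct_configReflect_eq_map, mul_mul_mul_comm, spinProduct_mul_spinProduct]
  have hT : Tendsto (fun L => isingExpect (zdGraph d) (symBox θ L) β 0 .free
      (fun τ => (∑ a, c a * spinProduct (A a) (configReflect θ τ)) *
        ∑ a, c a * spinProduct (A a) τ))
      atTop (𝓝 (∑ p : Fin m × Fin m, (c p.1 * c p.2) * plusCorr d β 0 (B p))) := by
    rw [hexp]
    simp_rw [isingExpect_sum_mul_spinProduct]
    exact tendsto_finsetSum _ fun p _ => (tendsto_isingCorr_free_symBox hR hβ hm (B p)).const_mul _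
  have h0 : 0 ≤ ∑ p : Fin m × Fin m, (c p.1 * c p.2) * plusCorr d β 0 (B p) :=
    ge_of_tendsto' hT hpos
  calc (0 : ℝ) ≤ ∑ p : Fin m × Fin m, (c p.1 * c p.2) * plusCorr d β 0 (B p) := h0
    _ = ∑ a, ∑ b, c a * c b * plusCorr d β 0 (((A a).map θ.toEmbedding) ∆ (A b)) := by
        rw [Fintype.sum_prod_type]
    _ = ∑ a, ∑ b, c b * c a * plusCorr d β 0 (symmDiff (A b) ((A a).image θ)) := by
        refine Finset.sum_congr rfl fun a _ => Finset.sum_congr rfl fun b _ => ?_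
        rw [mul_comm (c a) (c b), Finset.map_eq_image, Equiv.coe_toEmbedding, symmDiff_comm]
    _ = ∑ a, ∑ b, c a * c b * plusCorr d β 0 (symmDiff (A a) ((A b).image θ)) :=
        Finset.sum_comm

/-- **Reflection positivity of the plus state through a site mirror with an integer level.** Let
`θ` be an involutive automorphism of the nearest-neighbour graph `ℤ^d` preserving the centred
boxes and `ℓ : ℤ^d → ℤ` a level with `ℓ ∘ θ = -ℓ`, `θ = id` on `{ℓ = 0}` and `|ℓ x - ℓ y| ≤ 1`
along edges (the coordinate, diagonal and anti-diagonal mirrors). If `m*(β) = 0`, then for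
finite families `A_a ⊆ {ℓ ≥ 0}` and real `c_a`, `0 ≤ Σ_{a,b} c_a c_b ⟨σ_{A_a ∆ θA_b}⟩⁺_{β,0}`
(free finite volumes are reflection positive through sites, FILS 1978 §2 / Friedli–Velenik 2017
Lemma 10.8 — the tree's `isingExpect_free_reflect_mul_self_nonneg` — on the `θ`-stable boxes, and
the box limit). -/
theorem sum_sum_mul_plusCorr_symmDiff_nonneg_levelMirror (θ₀ : Site d → Site d)
    (hθ : Function.Involutive θ₀)
    (hθG : ∀ x y, (zdGraph d).Adj x y → (zdGraph d).Adj (θ₀ x) (θ₀ y))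
    (ℓ : Site d → ℤ) (hℓθ : ∀ x, ℓ (θ₀ x) = -ℓ x) (hfix : ∀ x, ℓ x = 0 → θ₀ x = x)
    (hadj : ∀ x y, (zdGraph d).Adj x y → ℓ x ≤ ℓ y + 1 ∧ ℓ y ≤ ℓ x + 1)
    (hbox : ∀ (L : ℕ) (x : Site d), x ∈ box d L → θ₀ x ∈ box d L)
    {β : ℝ} (hβ : 0 ≤ β) (hm : spontaneousMagnetization d β = 0)
    {m : ℕ} (A : Fin m → Finset (Site d)) (c : Fin m → ℝ) (hA : ∀ a, ∀ p ∈ A a, 0 ≤ ℓ p) :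
    0 ≤ ∑ a, ∑ b, c a * c b * plusCorr d β 0 (symmDiff (A a) ((A b).image θ₀)) := by
  classical
  let θe : Site d ≃ Site d := hθ.toPerm _
  have hθe : ∀ x, θe x = θ₀ x := fun x => rfl
  let P : Set (Site d) := {x | 0 ≤ ℓ x}
  have hmemP : ∀ x, x ∈ P ↔ 0 ≤ ℓ x := fun x => Iff.rfl
  have hmemθP : ∀ x, θe x ∈ P ↔ 0 ≤ -ℓ x := fun x => by rw [hmemP, hθe, hℓθ]
  have H1 : ∀ x, x ∈ P ∨ θe x ∈ P := fun x => by
    rw [hmemP, hmemθP]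
    omega
  have H2 : ∀ x ∈ P, θe x ∈ P → θe x = x := fun x hx hθx => by
    rw [hmemP] at hx
    rw [hmemθP] at hθx
    exact hfix x (by omega)
  have H3 : ∀ x y, (zdGraph d).Adj x y → (x ∈ P ∧ y ∈ P) ∨ (θe x ∈ P ∧ θe y ∈ P) :=
    fun x y hxy => by
      have h := hadj x y hxy
      rw [hmemP, hmemP, hmemθP, hmemθP]
      omega
  have hR : ∀ L, ∀ y ∈ box d L, θe y ∈ box d (L + 0) := fun L y hy => by
    rw [Nat.add_zero]
    exact hbox L y hy
  exact sum_sum_mul_plusCorr_symmDiff_nonneg_of_free θe hR hβ hm A c fun L =>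
    isingExpect_free_reflect_mul_self_nonneg (zdGraph d) θe hθ hθG (fun x => mem_symBox_iff hθ x)
      H1 H2 H3 β 0 (measurable_sum_mul_spinProduct A c)
      (dependsOn_sum_mul_spinProduct A c fun a p hp => (hmemP p).2 (hA a p hp))
      ⟨_, abs_sum_mul_spinProduct_le A c⟩

/-- The bond mirror `x ↦ (x with x_i ↦ 1 - x_i)` of `ℤ^d` (reflection in the hyperplane
`x_i = 1/2`) is the tree's `axisRefl i 1`. -/
theorem bondMirror_eq_axisRefl (i : Fin d) :
    (fun x : Site d => Function.update x i (1 - x i)) = ⇑(axisRefl i 1) := by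
  funext x j
  rw [axisRefl_apply]
  by_cases hj : j = i
  · subst hj
    simp
  · simp [hj]

/-- **Reflection positivity of the plus state through a bond mirror.** For the reflection of `ℤ^d`
in the hyperplane `x_i = 1/2` and `m*(β) = 0`, `β ≥ 0`: for finite families `A_a ⊆ {x_i ≥ 1}` and
real `c_a`, `0 ≤ Σ_{a,b} c_a c_b ⟨σ_{A_a ∆ θA_b}⟩⁺_{β,0}` (free finite volumes of the n.n.
ferromagnet are reflection positive through bonds, FILS 1978 §2 / Friedli–Velenik 2017 Lemma 10.8 —
the tree's `isingExpect_free_reflect_mul_self_nonneg_of_cross` — on the `θ`-symmetrised boxes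
`Λ(L) ∪ θΛ(L)`, and the box limit). -/
theorem sum_sum_mul_plusCorr_symmDiff_nonneg_bondMirror (i : Fin d) {β : ℝ} (hβ : 0 ≤ β)
    (hm : spontaneousMagnetization d β = 0) {m : ℕ} (A : Fin m → Finset (Site d))
    (c : Fin m → ℝ) (hA : ∀ a, ∀ p ∈ A a, 1 ≤ p i) :
    0 ≤ ∑ a, ∑ b, c a * c b *
      plusCorr d β 0 (symmDiff (A a) ((A b).image fun x => Function.update x i (1 - x i))) := by
  classical
  rw [bondMirror_eq_axisRefl]
  let P : Set (Site d) := {x | 1 ≤ x i}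
  have hmemP : ∀ x, x ∈ P ↔ 1 ≤ x i := fun x => Iff.rfl
  have hP : ∀ x, x ∈ P ↔ axisRefl i 1 x ∉ P := fun x => by
    rw [hmemP, hmemP, axisRefl_apply, if_pos rfl]
    omega
  have hcross : ∀ x y, (zdGraph d).Adj x y → x ∈ P → y ∉ P → y = axisRefl i 1 x := by
    intro x y hxy hx hy
    rw [hmemP] at hx hy
    obtain ⟨l, hl, hrest⟩ := zdGraph_adj_coord hxy
    funext j
    rw [axisRefl_apply]
    by_cases hj : j = i
    · subst hj
      rw [if_pos rfl]
      by_cases hlj : l = j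
      · subst hlj
        omega
      · have := hrest j (Ne.symm hlj) ▸ hx
        omega
    · rw [if_neg hj]
      by_cases hlj : l = j
      · subst hlj
        have := hrest i (fun h => hj h.symm)
        omega
      · exact hrest j (Ne.symm hlj) ▸ rfl
  have hR : ∀ L, ∀ y ∈ box d L, axisRefl i 1 y ∈ box d (L + 1) := fun L y hy => by
    simpa using axisRefl_mem_box i 1 L y hy
  exact sum_sum_mul_plusCorr_symmDiff_nonneg_of_free (axisRefl i 1) hR hβ hm A c fun L =>
    isingExpect_free_reflect_mul_self_nonneg_of_cross (zdGraph d) (axisRefl i 1)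
      (axisRefl_involutive i 1) (fun x y h => (zdGraph_adj_axisRefl i 1 x y).2 h)
      (fun x => mem_symBox_iff (axisRefl_involutive i 1) x) hP hcross hβ 0
      (measurable_sum_mul_spinProduct A c)
      (dependsOn_sum_mul_spinProduct A c fun a p hp => (hmemP p).2 (hA a p hp))
      ⟨_, abs_sum_mul_spinProduct_le A c⟩

end RP

/-! ### The four lattice mirror types of the route, at `d = 3`, `β = β_c(3)` -/

open Summit.CriticalPhenomena.Ising3DConformalLimit.Cruxes.InversionUpgradeNormalised.FreeEndpointGaussianClosure
  in
open Summit.CriticalPhenomena.Ising3DConformalLimit.HyperoctahedralRPNineMirror in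
/-- **Row 3 for the critical plus state of `ℤ³`: reflection positivity in the four lattice mirror
types** (site plane `x_i = 0`, bond plane `x_i = 1/2`, diagonal plane `x_i = x_j`, anti-diagonal
plane `x_i = -x_j`): `0 ≤ Σ_{a,b} c_a c_b ⟨σ_{A_a ∆ θA_b}⟩⁺_{β_c(3),0}` for finite families
`A_a ⊆ {ℓ ≥ 0}`. The three site-type mirrors are involutive graph automorphisms with an integer
level (FILS 1978, Thm. 3.1), the bond mirror is the n.n.-ferromagnetic bond case; `m*(β_c) = 0` in
`d = 3` (Aizenman–Duminil-Copin–Sidoravicius 2015) identifies the limit of the free states with the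
plus state. -/
theorem plusCorr_criticalBeta_fourMirror_rp {θ : Site 3 → Site 3} {ℓ : Site 3 → ℤ}
    (hθℓ : ∃ i j : Fin 3, i ≠ j ∧
      ((θ = fun x => Function.update x i (-x i)) ∧ (ℓ = fun x => x i) ∨
       (θ = fun x => Function.update x i (1 - x i)) ∧ (ℓ = fun x => 2 * x i - 1) ∨
       (θ = fun x => x ∘ Equiv.swap i j) ∧ (ℓ = fun x => x i - x j) ∨
       (θ = fun x => Function.update (Function.update x i (-x j)) j (-x i)) ∧
         (ℓ = fun x => x i + x j)))
    {m : ℕ} (A : Fin m → Finset (Site 3)) (c : Fin m → ℝ) (hA : ∀ a, ∀ p ∈ A a, 0 ≤ ℓ p) :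
    0 ≤ ∑ a, ∑ b, c a * c b *
      plusCorr 3 (criticalBeta 3) 0 (symmDiff (A a) ((A b).image θ)) := by
  have hβ : 0 ≤ criticalBeta 3 := criticalBeta_nonneg 3
  have hm : spontaneousMagnetization 3 (criticalBeta 3) = 0 :=
    spontaneousMagnetization_criticalBeta_eq_zero_holds (d := 3) (by norm_num)
  obtain ⟨i, j, hij, ⟨rfl, rfl⟩ | ⟨rfl, rfl⟩ | ⟨rfl, rfl⟩ | ⟨rfl, rfl⟩⟩ := hθℓ
  · -- coordinate mirror `x_i ↦ -x_i`, level `x_i`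
    refine sum_sum_mul_plusCorr_symmDiff_nonneg_levelMirror _ (mirror_involutive i)
      (fun x y h => mirror_adj i h) (fun x => x i) (fun x => by simp) (fun x hx0 => ?_)
      (fun x y h => apply_le_add_one_of_adj i h) (fun L x hx => mirror_mem_box i hx) hβ hm A c hA
    have hx0' : x i = 0 := hx0
    rw [hx0', neg_zero, ← hx0', Function.update_eq_self]
  · -- bond mirror `x_i ↦ 1 - x_i`, level `2 x_i - 1`
    exact sum_sum_mul_plusCorr_symmDiff_nonneg_bondMirror i hβ hm A c fun a p hp => by
      have h := hA a p hp
      dsimp only at h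
      omega
  · -- diagonal mirror (swap), level `x_i - x_j`
    refine sum_sum_mul_plusCorr_symmDiff_nonneg_levelMirror _ (swapMirror_involutive i j)
      (fun x y h => ?_) (fun x => x i - x j) (fun x => ?_) (fun x hx0 => ?_)
      (fun x y h => sub_le_add_one_of_adj i j h) (fun L x hx => ?_) hβ hm A c hA
    · have h' := zdGraph_adj_signedPerm (Equiv.swap i j) 1 h
      rw [← swapMirror_eq_signedPerm] at h'
      exact h'
    · simp [Equiv.swap_apply_left, Equiv.swap_apply_right]
    · have hx0' : x i - x j = 0 := hx0
      funext l
      simp only [Function.comp_apply]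
      by_cases hli : l = i
      · subst hli; rw [Equiv.swap_apply_left]; omega
      · by_cases hlj : l = j
        · subst hlj; rw [Equiv.swap_apply_right]; omega
        · rw [Equiv.swap_apply_of_ne_of_ne hli hlj]
    · have h' := (signedPerm_mem_box_iff (Equiv.swap i j) 1 (n := L) (x := x)).2 hx
      rw [← swapMirror_eq_signedPerm] at h'
      exact h'
  · -- anti-diagonal mirror, level `x_i + x_j`
    refine sum_sum_mul_plusCorr_symmDiff_nonneg_levelMirror _ (antiMirror_involutive hij)
      (fun x y h => ?_) (fun x => x i + x j) (fun x => ?_) (fun x hx0 => ?_)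
      (fun x y h => add_le_add_one_of_adj hij h) (fun L x hx => ?_) hβ hm A c hA
    · have h' := zdGraph_adj_signedPerm (Equiv.swap i j)
        (fun l => if l = i ∨ l = j then -1 else 1) h
      rw [← antiMirror_eq_signedPerm hij] at h'
      exact h'
    · simp [Function.update_of_ne hij, add_comm]
    · have hx0' : x i + x j = 0 := hx0
      funext l
      by_cases hlj : l = j
      · subst hlj
        rw [Function.update_self]
        omega
      · by_cases hli : l = i
        · subst hli
          rw [Function.update_of_ne hlj, Function.update_self]
          omega
        · rw [Function.update_of_ne hlj, Function.update_of_ne hli]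
    · have h' := (signedPerm_mem_box_iff (Equiv.swap i j)
        (fun l => if l = i ∨ l = j then -1 else 1) (n := L) (x := x)).2 hx
      rw [← antiMirror_eq_signedPerm hij] at h'
      exact h'

end Summit.CriticalPhenomena.Ising3DConformalLimit.LatticeSDPCertificatesFeasible

end
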